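import Summits.Ventures.HodgeRepro2.T7SupportRegularTransport
import Summits.Ventures.HodgeRepro2.Tier7.Line3.KappaIsolation

/-!
# Regularity read at ONE place suffices (support, seat p1)

Row 721 (`T7SupportRegularStabilizer`) displays the regularity of the local representative as `Regular P γ` (the matrix of
`γ` from the second basis is not monomial), row 722 (`T7SupportRegularTransport`) transports it along any ring
homomorphism, and L1-p5's `Tier7/Line3/KappaIsolation` (p678820) reads the invariant `κ` of row 662 locally:
`ψ (κ γ) ≠ 0 ↔ κ γ ≠ 0`, `ψ (κ γ) ≠ 1 ↔ κ γ ≠ 1` for every ring homomorphism `ψ` out of the global field `E`. Composing: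

* `regular_map_iff_map`, `regular_GL_map_iff_map` — for ring homomorphisms `ψ₁ : E →+* F₁`, `ψ₂ : E →+* F₂` between
  fields, the images of `(γ, P)` are regular at `ψ₁` iff they are regular at `ψ₂` (both iff `Regular P γ` over `E`);
* **`regular_of_map_kappa`**, `regular_GL_map_of_map_kappa` — if `κ(γ)` read at ONE place `ψ₁` is `∉ {0, 1}` (row 721's
  binders for the κ-form: the orthogonal data and `IsIsom σ d γ` over `E`, nothing else), the image of `(γ, P)` under ANY
  `ψ₂` is `Regular` — in particular at the level place.

So `γ₀` is regular — `κ(γ₀) ∉ {0, 1}` in `E`, read at ANY embedding: the REGULARITY clause of the archimedean choice of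
(b′) (`κ_v(γ₀) ≠ 1` at `ι₂` / `ι₃`, where the model's `κ` of `T7SupportKappaCartan` / `T7SupportCompactRegularPoint`
reads row 662's `κ` through L1-p5's `KappaNatural.kappa_eq_normSq`) and the `v₁` regularity are one condition on the
global `γ₀`. The archimedean choice of (b′) has a SECOND clause — the non-vanishing of the two-vector coefficient
`⟨u_A, π⁰_v(γ₀ h_v) u_A⟩` on the open locus (rows 680 / 695 / 715 / 716: `regularNonvanishing` = both clauses) — which
this row does not touch: it stays a separate condition of the choice (t7-crit-1's precision, STATUS l. 15934). In words
(the dictionary, unchanged): which `ψ₁` (an archimedean embedding) and which `ψ₂` (the `v₁` completion) the real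
objects use.
Nothing here is about (N), (P), the real `X`, or HC_CM; §8(d): NO. Blind lane: Mathlib + the HodgeRepro2 prefix; no sorry;
axioms ⊆ {propext, Classical.choice, Quot.sound}.
-/

namespace Summit.Ventures.HodgeRepro2.T7SupportRegularOnePlace

open Matrix Summit.Ventures.HodgeRepro2.T7SupportTwoTorusInvariant
  Summit.Ventures.HodgeRepro2.T7SupportRegularStabilizer
  Summit.Ventures.HodgeRepro2.T7SupportRegularTransport
  Summit.Ventures.HodgeRepro2.Tier7.Line3.KappaIsolation

variable {E F₁ F₂ : Type*} [Field E] [Field F₁] [Field F₂] (ψ₁ : E →+* F₁) (ψ₂ : E →+* F₂)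

/-- **regular at one place ⟺ regular at any other** (hypothesis form: units whose matrices are the images). -/
theorem regular_map_iff_map {γ P : GL (Fin 2) E} {γ₁ P₁ : GL (Fin 2) F₁} {γ₂ P₂ : GL (Fin 2) F₂}
    (hγ₁ : (γ₁ : Matrix (Fin 2) (Fin 2) F₁) = (γ : Matrix (Fin 2) (Fin 2) E).map ψ₁)
    (hP₁ : (P₁ : Matrix (Fin 2) (Fin 2) F₁) = (P : Matrix (Fin 2) (Fin 2) E).map ψ₁)
    (hγ₂ : (γ₂ : Matrix (Fin 2) (Fin 2) F₂) = (γ : Matrix (Fin 2) (Fin 2) E).map ψ₂)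
    (hP₂ : (P₂ : Matrix (Fin 2) (Fin 2) F₂) = (P : Matrix (Fin 2) (Fin 2) E).map ψ₂) :
    Regular P₁ γ₁ ↔ Regular P₂ γ₂ := by
  rw [regular_map_iff ψ₁ hγ₁ hP₁, regular_map_iff ψ₂ hγ₂ hP₂]

/-- the same for Mathlib's `GeneralLinearGroup.map`. -/
theorem regular_GL_map_iff_map (γ P : GL (Fin 2) E) :
    Regular (GeneralLinearGroup.map ψ₁ P) (GeneralLinearGroup.map ψ₁ γ) ↔
      Regular (GeneralLinearGroup.map ψ₂ P) (GeneralLinearGroup.map ψ₂ γ) := by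
  rw [regular_GL_map_iff ψ₁, regular_GL_map_iff ψ₂]

/-- **`κ` read at ONE place suffices**: `ψ₁ (κ γ) ∉ {0, 1}` gives `Regular` for the image of `(γ, P)` under ANY `ψ₂`
(row 721's binders for the κ-form, nothing else). -/
theorem regular_of_map_kappa (σ : E →+* E) (d : Fin 2 → E) (hd : ∀ i, σ (d i) = d i) (hd0 : ∀ i, d i ≠ 0)
    (f : Fin 2 → Fin 2 → E) (hf0 : disc' σ d f 0 ≠ 0) {P γ : GL (Fin 2) E}
    (hP : ∀ j, (P : Matrix (Fin 2) (Fin 2) E).col j = f j)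
    (hγ : IsIsom σ d (γ : Matrix (Fin 2) (Fin 2) E))
    (hκ0 : ψ₁ (kappa σ d f (γ : Matrix (Fin 2) (Fin 2) E)) ≠ 0)
    (hκ1 : ψ₁ (kappa σ d f (γ : Matrix (Fin 2) (Fin 2) E)) ≠ 1) {γ₂ P₂ : GL (Fin 2) F₂}
    (hγ₂ : (γ₂ : Matrix (Fin 2) (Fin 2) F₂) = (γ : Matrix (Fin 2) (Fin 2) E).map ψ₂)
    (hP₂ : (P₂ : Matrix (Fin 2) (Fin 2) F₂) = (P : Matrix (Fin 2) (Fin 2) E).map ψ₂) : Regular P₂ γ₂ :=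
  regular_map_of_kappa ψ₂ σ d hd hd0 f hf0 hP hγ ((map_kappa_ne_zero_iff σ ψ₁ d f _).1 hκ0)
    ((map_kappa_ne_one_iff σ ψ₁ d f _).1 hκ1) hγ₂ hP₂

/-- the same at `GeneralLinearGroup.map ψ₂`. -/
theorem regular_GL_map_of_map_kappa (σ : E →+* E) (d : Fin 2 → E) (hd : ∀ i, σ (d i) = d i)
    (hd0 : ∀ i, d i ≠ 0) (f : Fin 2 → Fin 2 → E) (hf0 : disc' σ d f 0 ≠ 0) {P γ : GL (Fin 2) E}
    (hP : ∀ j, (P : Matrix (Fin 2) (Fin 2) E).col j = f j)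
    (hγ : IsIsom σ d (γ : Matrix (Fin 2) (Fin 2) E))
    (hκ0 : ψ₁ (kappa σ d f (γ : Matrix (Fin 2) (Fin 2) E)) ≠ 0)
    (hκ1 : ψ₁ (kappa σ d f (γ : Matrix (Fin 2) (Fin 2) E)) ≠ 1) :
    Regular (GeneralLinearGroup.map ψ₂ P) (GeneralLinearGroup.map ψ₂ γ) :=
  regular_of_map_kappa ψ₁ ψ₂ σ d hd hd0 f hf0 hP hγ hκ0 hκ1 rfl rfl

end Summit.Ventures.HodgeRepro2.T7SupportRegularOnePlace
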